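import Summits.QuantumFields.BalabanUV.Beta.FP.MixLoopPowerCountingMass

/-!
# `BalabanUV.Beta.FP.MixLoopPowerCountingMassQuartic` — road «FP» (binder row D1), row **RHOA-6c′** «MASS-CURRENCY POWER COUNTING OF THE MIX LOOPS», the
# **(MIX-4)** twin `tr(Q̈·𝓘)`: FILE A's (MIX-4) with the uniform pair mass `A₂∕n³` replaced by the INLINE pair-mass function `M₂(b,b′) = Σ_{u∈U b}Σ_{w∈W}|q̈(u;b,b′;b+w)|`, and
# the second moment taken for the COARSE kernel `T₄(v₀,v) = Σ_{b,b′} J(b,v₀)·J(b′,v)·k₄(b,b′)` in the road-FP OWNER's mass currency (`FP/MixLoopPowerCountingMass`, R-FP-26)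
# ([folklore] lattice bookkeeping on `ℤ⁴`; abstract kernels, every letter a displayed hypothesis; NO road object)

HONEST DEPENDENCY (page 1, mandatory): continuum YM on T⁴ ⇐ BetaPertH ∧ nine spine estimates (0/9 proved); BetaPertH ⇐ (D1) ∧ (D4) ∧
CAP+tail; G-an2-4 gates asym, D1 and NE2/3/4.  HONEST FRAMING (cell contract, verbatim): «discharging `BetaPertH` makes Bałaban's UV
stability UNCONDITIONAL — a real constructive-QFT result; it is NOT the continuum limit and NOT the Clay problem.»  THIS MODULE is elementary
[folklore] real analysis on `ℤ⁴` over the owner's `FP/MixLoopPowerCountingMass` BY NAME (`sq_div_mul_exp_le` — a square costs no power of `n` against an exponential at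
rate `∕n` —, `sq_coarse_sep_le` — the coarse separation against the three fine ones) and FILE A's `MixLoopPowerCounting.supNorm_cast_nonneg`; it asserts nothing about
Bałaban's objects, cites nothing, mints no `Prop` fact, has no `def`, 0 sorry.  NOT `Mix_n = O(1)` for Bałaban's objects (row RHOA-6e assembles), NOT `hbook`, NOT D1,
NOT BetaPertH, NOT continuum, NOT Clay.

ROW (R-FP-26 (b), `ROOTING-MIX.md` §2 (ii) «(MIX-4)'s 4-jet: the rooted second-order words have the same length letter ℓ, mass ≤ ℓ²·n⁴·(norm) per coarse bond =
constant × straight»; owner l.24763 «the (MIX-4) twin is 30 lines: `|k₄(b,b′)| ≤ C_I·M₂(b,b′)` + the same §3 with a pair-mass letter»).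
THE LETTERS (displayed; `n ≥ 1`): (I₀) the sup letter of the loop's interpolation leg `|I c u| ≤ C_I` (ONLY); (J) reference-leg insertion weight
`|J b v₀| ≤ C_J·e^{−(δ∕n)‖b − n•v₀‖∞}`; (J′) running-leg coarse moments `Σ_{v∈V}(1 + ‖b′ − n•v‖∞²∕n²)·|J b′ v| ≤ C_J′` (every `b′`); (M₂) the EXPONENTIALLY WINDOWED PAIR
MASS with the pair's own separation weight `Σ_{b∈S}Σ_{b′∈S} e^{−(δ∕(2n))‖b − n•v₀‖∞}·(1 + ‖b′−b‖∞²∕n²)·M₂(b,b′) ≤ A₂M` (the factor `(1 + ‖b′−b‖²∕n²)` replaces a support-radius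
letter: `≤ 1 + R²` on a 4-jet supported at `‖b′−b‖ ≤ R·n`).
CONTENT: `abs_mix4_le_mass` (`|k₄(b,b′)| ≤ C_I·M₂(b,b′)`), `runningLeg_moment_le` (`Σ_v‖v−v₀‖²|J b′ v| ≤ 3C_J′((‖b−n•v₀‖∕n)² + (‖b′−b‖∕n)² + 1)`),
`weight_profile_le` (`|J b v₀|·((‖b−n•v₀‖∕n)² + (‖b′−b‖∕n)² + 1) ≤ C_J(1 + 16∕δ²)(1 + ‖b′−b‖²∕n²)e^{−(δ∕2n)‖b−n•v₀‖}`), the generic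
**`coarse_secondMoment_of_majorant`** (THE J-CONTRACTION LEMMA: any majorant `|k| ≤ κ` with the windowed letter (Mκ) ⟹ `Σ_v‖v−v₀‖²|Σ JJ′k| ≤ 3C_JC_J′(1 + 16∕δ²)A_κ` —
serves the (MIX-1)∕(MIX-3) mass twins verbatim), **`coarse_mix4_secondMoment_le`** (`≤ 3·C_J·C_J′·(1 + 16∕δ²)·(C_I·A₂M)`, n-FREE; FILE A's `mix4_secondMoment_le` is the uniform
special case).
Provenance: cross-cell idle-seat kernel duty NE7b → β∕D1, unit `b2b-balaban-t4-ne7b-formalise-leaf-01` gen 23 (first-refusal holder of RHOA-6c′, journal l.24895 ∕ l.24911),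
2026-08-21; «not in print; our bookkeeping»; no existing file touched.
-/

noncomputable section

namespace Summit.QuantumFields.BalabanUV.Beta.FP.MixLoopPowerCountingMassQuartic

open Finset Real
open scoped BigOperators
open Literature.MathematicalPhysics.QuantumFieldTheory.Balaban1983to89.Beta.DyadicShell (Pt supNorm)
open Summit.QuantumFields.BalabanUV.Beta.FP.MixLoopPowerCounting (supNorm_cast_nonneg)
open Summit.QuantumFields.BalabanUV.Beta.FP.MixLoopPowerCountingMass (sq_div_mul_exp_le sq_coarse_sep_le)

section Mix4

variable {U : Pt → Finset Pt} {W : Finset Pt} {qdd : Pt → Pt → Pt → Pt → ℝ} {I J : Pt → Pt → ℝ} {C_I C_J C_J' A₂M δ : ℝ} {n : ℕ}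

/-- **(MIX-4) POINTWISE WITH THE PAIR MASS INLINE**: `|k₄(b,b′)| = |Σ_{u∈U b}Σ_{w∈W} q̈(u;b,b′;b+w)·𝓘(b+w,u)| ≤ C_I·Σ_{u∈U b}Σ_{w∈W}|q̈(u;b,b′;b+w)|` — ONLY the sup
letter of the leg `𝓘`. [folklore] -/
theorem abs_mix4_le_mass (hI : ∀ c u, |I c u| ≤ C_I) (b b' : Pt) :
    |∑ u ∈ U b, ∑ w ∈ W, qdd u b b' (b + w) * I (b + w) u| ≤ C_I * ∑ u ∈ U b, ∑ w ∈ W, |qdd u b b' (b + w)| := by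
  calc |∑ u ∈ U b, ∑ w ∈ W, qdd u b b' (b + w) * I (b + w) u|
      ≤ ∑ u ∈ U b, ∑ w ∈ W, |qdd u b b' (b + w)| * C_I := by
        refine (Finset.abs_sum_le_sum_abs _ _).trans (Finset.sum_le_sum fun u _ =>
          (Finset.abs_sum_le_sum_abs _ _).trans (Finset.sum_le_sum fun w _ => ?_))
        rw [abs_mul]
        exact mul_le_mul_of_nonneg_left (hI _ _) (abs_nonneg _)
    _ = C_I * ∑ u ∈ U b, ∑ w ∈ W, |qdd u b b' (b + w)| := by
        rw [Finset.mul_sum]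
        refine Finset.sum_congr rfl fun u _ => ?_
        rw [Finset.mul_sum]
        exact Finset.sum_congr rfl fun w _ => mul_comm _ _

/-- [folklore] **THE RUNNING LEG's COARSE SECOND MOMENT** from (J′) and the three-point split:
`Σ_{v∈V} ‖v−v₀‖∞²·|J b′ v| ≤ 3·C_J′·((‖b−n•v₀‖∕n)² + (‖b′−b‖∕n)² + 1)`. -/
theorem runningLeg_moment_le (hn : 1 ≤ n) (V : Finset Pt) (v₀ b b' : Pt)
    (hJ' : ∑ v ∈ V, (1 + ((supNorm (b' - (n : ℤ) • v) : ℝ) / n) ^ 2) * |J b' v| ≤ C_J') :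
    ∑ v ∈ V, (supNorm (v - v₀) : ℝ) ^ 2 * |J b' v|
      ≤ 3 * C_J' * ((((supNorm (b - (n : ℤ) • v₀) : ℝ) / n) ^ 2 + ((supNorm (b' - b) : ℝ) / n) ^ 2) + 1) := by
  set x : ℝ := ((supNorm (b - (n : ℤ) • v₀) : ℝ) / n) ^ 2 + ((supNorm (b' - b) : ℝ) / n) ^ 2 with hx
  have hx0 : 0 ≤ x := by positivity
  have hCJ' : 0 ≤ C_J' := le_trans (Finset.sum_nonneg fun v _ => by positivity) hJ'
  have h0 : ∑ v ∈ V, |J b' v| ≤ C_J' :=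
    le_trans (Finset.sum_le_sum fun v _ => by
      have : (0 : ℝ) ≤ ((supNorm (b' - (n : ℤ) • v) : ℝ) / n) ^ 2 := by positivity
      nlinarith [abs_nonneg (J b' v)]) hJ'
  have h2 : ∑ v ∈ V, ((supNorm (b' - (n : ℤ) • v) : ℝ) / n) ^ 2 * |J b' v| ≤ C_J' :=
    le_trans (Finset.sum_le_sum fun v _ => by nlinarith [abs_nonneg (J b' v)]) hJ'
  calc ∑ v ∈ V, (supNorm (v - v₀) : ℝ) ^ 2 * |J b' v|
      ≤ ∑ v ∈ V, (3 * (x + ((supNorm (b' - (n : ℤ) • v) : ℝ) / n) ^ 2)) * |J b' v| := by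
        refine Finset.sum_le_sum fun v _ => mul_le_mul_of_nonneg_right ?_ (abs_nonneg _)
        have h := sq_coarse_sep_le hn v v₀ b b'
        rw [hx]; linarith
    _ = 3 * x * ∑ v ∈ V, |J b' v| + 3 * ∑ v ∈ V, ((supNorm (b' - (n : ℤ) • v) : ℝ) / n) ^ 2 * |J b' v| := by
        rw [Finset.mul_sum, Finset.mul_sum, ← Finset.sum_add_distrib]
        exact Finset.sum_congr rfl fun v _ => by ring
    _ ≤ 3 * x * C_J' + 3 * C_J' := by
        have : 0 ≤ 3 * x := by positivity
        nlinarith [mul_le_mul_of_nonneg_left h0 this]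
    _ = 3 * C_J' * (x + 1) := by ring

/-- [folklore] **THE REFERENCE LEG ABSORBS THE SQUARES** (exact power): `|J b v₀|·((‖b−n•v₀‖∕n)² + (‖b′−b‖∕n)² + 1) ≤ C_J·(1 + 16∕δ²)·(1 + (‖b′−b‖∕n)²)·e^{−(δ∕(2n))‖b−n•v₀‖}`
(`(x∕n)²e^{−(δ∕n)x} = [(x∕n)²e^{−(δ∕2n)x}]·e^{−(δ∕2n)x} ≤ (16∕δ²)·e^{−(δ∕2n)x}`, `MixLoopPowerCountingMass.sq_div_mul_exp_le` at rate `δ∕2`). -/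
theorem weight_profile_le (hδ : 0 < δ) (hn : 1 ≤ n) {v₀ b : Pt}
    (hJ : |J b v₀| ≤ C_J * Real.exp (-(δ / n) * (supNorm (b - (n : ℤ) • v₀) : ℝ))) (b' : Pt) :
    |J b v₀| * ((((supNorm (b - (n : ℤ) • v₀) : ℝ) / n) ^ 2 + ((supNorm (b' - b) : ℝ) / n) ^ 2) + 1)
      ≤ C_J * (1 + 16 / δ ^ 2) * (1 + ((supNorm (b' - b) : ℝ) / n) ^ 2)
          * Real.exp (-(δ / (2 * n)) * (supNorm (b - (n : ℤ) • v₀) : ℝ)) := by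
  have hn' : (0 : ℝ) < n := by exact_mod_cast hn
  set x : ℝ := (supNorm (b - (n : ℤ) • v₀) : ℝ) with hx
  set t : ℝ := ((supNorm (b' - b) : ℝ) / n) ^ 2 with ht
  have hx0 : 0 ≤ x := supNorm_cast_nonneg _
  have ht0 : 0 ≤ t := by positivity
  set E : ℝ := Real.exp (-(δ / (2 * n)) * x) with hE
  have hE0 : 0 < E := Real.exp_pos _
  have hCJ : 0 ≤ C_J := by
    have : 0 < Real.exp (-(δ / n) * x) := Real.exp_pos _
    nlinarith [abs_nonneg (J b v₀)]
  -- `e^{−(δ/n)x} = E·E`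
  have hsplit : Real.exp (-(δ / n) * x) = E * E := by
    rw [hE, ← Real.exp_add]; congr 1; field_simp; ring
  -- the square against one factor `E`
  have hsq : (x / n) ^ 2 * E ≤ 16 / δ ^ 2 := by
    have h := sq_div_mul_exp_le (x := x) (half_pos hδ) hn hx0
    have e1 : -(δ / 2 / n) * x = -(δ / (2 * n)) * x := by field_simp
    have e2 : (4 : ℝ) / (δ / 2) ^ 2 = 16 / δ ^ 2 := by field_simp; ring
    rw [e1, e2] at h
    exact h
  have hE1 : E ≤ 1 := by
    rw [hE]; apply Real.exp_le_one_iff.mpr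
    have : 0 < δ / (2 * n) := by positivity
    nlinarith
  calc |J b v₀| * (((x / n) ^ 2 + t) + 1) ≤ (C_J * (E * E)) * (((x / n) ^ 2 + t) + 1) := by
        rw [← hsplit]; exact mul_le_mul_of_nonneg_right hJ (by positivity)
    _ = C_J * E * ((x / n) ^ 2 * E + (t + 1) * E) := by ring
    _ ≤ C_J * E * (16 / δ ^ 2 + (t + 1) * 1) := by
        gcongr
    _ ≤ C_J * (1 + 16 / δ ^ 2) * (1 + t) * E := by
        have h16 : 0 ≤ 16 / δ ^ 2 := by positivity
        nlinarith [mul_nonneg (mul_nonneg hCJ hE0.le) (mul_nonneg h16 ht0)]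

/-- **THE J-CONTRACTION LEMMA (generic; serves every MIX loop)**: if the fine loop kernel has a nonnegative majorant `|k(b,b′)| ≤ κ(b,b′)`, then under the
reference-leg letter (J), the running-leg coarse moments (J′) and the WINDOWED MAJORANT letter (Mκ) `Σ_{b∈S}Σ_{b′∈S} e^{−(δ∕(2n))‖b−n•v₀‖}·(1 + ‖b′−b‖²∕n²)·κ(b,b′) ≤ A_κ`,
the coarse second moment of the J-contracted kernel is `Σ_{v∈V}‖v−v₀‖∞²·|Σ_{b,b′∈S} J b v₀·J b′ v·k(b,b′)| ≤ 3·C_J·C_J′·(1 + 16∕δ²)·A_κ` — n-FREE; the three fine separations of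
`sq_coarse_sep_le` are paid by (J′) (running leg), by (J) (reference leg: the square costs no power, `weight_profile_le`) and by the pair weight inside (Mκ). [folklore] -/
theorem coarse_secondMoment_of_majorant {k κ : Pt → Pt → ℝ} {A_κ : ℝ} (hδ : 0 < δ) (hn : 1 ≤ n) (S V : Finset Pt) (v₀ : Pt)
    (hk : ∀ b b', |k b b'| ≤ κ b b')
    (hJ : ∀ b, |J b v₀| ≤ C_J * Real.exp (-(δ / n) * (supNorm (b - (n : ℤ) • v₀) : ℝ)))
    (hJ' : ∀ b', ∑ v ∈ V, (1 + ((supNorm (b' - (n : ℤ) • v) : ℝ) / n) ^ 2) * |J b' v| ≤ C_J')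
    (hMκ : ∑ b ∈ S, ∑ b' ∈ S, Real.exp (-(δ / (2 * n)) * (supNorm (b - (n : ℤ) • v₀) : ℝ)) *
        (1 + ((supNorm (b' - b) : ℝ) / n) ^ 2) * κ b b' ≤ A_κ) :
    ∑ v ∈ V, (supNorm (v - v₀) : ℝ) ^ 2 * |∑ b ∈ S, ∑ b' ∈ S, J b v₀ * J b' v * k b b'|
      ≤ 3 * C_J * C_J' * (1 + 16 / δ ^ 2) * A_κ := by
  have hCJ' : 0 ≤ C_J' := le_trans (Finset.sum_nonneg fun v _ => by positivity) (hJ' v₀)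
  have hCJ : 0 ≤ C_J := by
    have h := hJ ((n : ℤ) • v₀)
    have e : Real.exp (-(δ / n) * (supNorm ((n : ℤ) • v₀ - (n : ℤ) • v₀) : ℝ)) = 1 := by simp
    exact (abs_nonneg _).trans (by rw [e, mul_one] at h; exact h)
  have hκ0 : ∀ b b', 0 ≤ κ b b' := fun b b' => (abs_nonneg _).trans (hk b b')
  set Φ : Pt → Pt → ℝ := fun b b' => (((supNorm (b - (n : ℤ) • v₀) : ℝ) / n) ^ 2 + ((supNorm (b' - b) : ℝ) / n) ^ 2) + 1 with hΦ
  set E : Pt → ℝ := fun b => Real.exp (-(δ / (2 * n)) * (supNorm (b - (n : ℤ) • v₀) : ℝ)) with hE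
  -- STEP 1: absolute values inside, the majorant, the sum over `v` innermost
  have step1 : ∀ v ∈ V, (supNorm (v - v₀) : ℝ) ^ 2 * |∑ b ∈ S, ∑ b' ∈ S, J b v₀ * J b' v * k b b'|
        ≤ ∑ b ∈ S, ∑ b' ∈ S, |J b v₀| * κ b b' * ((supNorm (v - v₀) : ℝ) ^ 2 * |J b' v|) := by
    intro v _
    have h0 : 0 ≤ (supNorm (v - v₀) : ℝ) ^ 2 := by positivity
    calc _ ≤ (supNorm (v - v₀) : ℝ) ^ 2 * ∑ b ∈ S, ∑ b' ∈ S, |J b v₀| * |J b' v| * κ b b' := by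
          refine mul_le_mul_of_nonneg_left ((Finset.abs_sum_le_sum_abs _ _).trans (Finset.sum_le_sum fun b _ =>
            (Finset.abs_sum_le_sum_abs _ _).trans (Finset.sum_le_sum fun b' _ => ?_))) h0
          rw [abs_mul, abs_mul]
          exact mul_le_mul_of_nonneg_left (hk b b') (by positivity)
      _ = _ := by
          rw [Finset.mul_sum]
          refine Finset.sum_congr rfl fun b _ => ?_
          rw [Finset.mul_sum]
          exact Finset.sum_congr rfl fun b' _ => by ring
  -- STEP 2: swap `Σ_v` inside; the running leg's moment, then the reference leg absorbs the squares
  have step2 : ∀ b ∈ S, ∀ b' ∈ S, ∑ v ∈ V, |J b v₀| * κ b b' * ((supNorm (v - v₀) : ℝ) ^ 2 * |J b' v|)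
      ≤ (3 * C_J * C_J' * (1 + 16 / δ ^ 2)) * (E b * (1 + ((supNorm (b' - b) : ℝ) / n) ^ 2) * κ b b') := by
    intro b _ b' _
    rw [← Finset.mul_sum]
    have h1 := runningLeg_moment_le (J := J) hn V v₀ b b' (hJ' b')
    have h2 := weight_profile_le (J := J) hδ hn (hJ b) b'
    calc |J b v₀| * κ b b' * ∑ v ∈ V, (supNorm (v - v₀) : ℝ) ^ 2 * |J b' v|
        ≤ |J b v₀| * κ b b' * (3 * C_J' * Φ b b') := mul_le_mul_of_nonneg_left h1 (mul_nonneg (abs_nonneg _) (hκ0 b b'))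
      _ = (3 * C_J' * κ b b') * (|J b v₀| * Φ b b') := by ring
      _ ≤ (3 * C_J' * κ b b') * (C_J * (1 + 16 / δ ^ 2) * (1 + ((supNorm (b' - b) : ℝ) / n) ^ 2) * E b) :=
          mul_le_mul_of_nonneg_left h2 (by have := hκ0 b b'; positivity)
      _ = _ := by ring
  calc _ ≤ ∑ v ∈ V, ∑ b ∈ S, ∑ b' ∈ S, |J b v₀| * κ b b' * ((supNorm (v - v₀) : ℝ) ^ 2 * |J b' v|) := Finset.sum_le_sum step1
    _ = ∑ b ∈ S, ∑ b' ∈ S, ∑ v ∈ V, |J b v₀| * κ b b' * ((supNorm (v - v₀) : ℝ) ^ 2 * |J b' v|) := by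
        rw [Finset.sum_comm]; exact Finset.sum_congr rfl fun b _ => Finset.sum_comm
    _ ≤ ∑ b ∈ S, ∑ b' ∈ S, (3 * C_J * C_J' * (1 + 16 / δ ^ 2)) * (E b * (1 + ((supNorm (b' - b) : ℝ) / n) ^ 2) * κ b b') :=
        Finset.sum_le_sum fun b hb => Finset.sum_le_sum fun b' hb' => step2 b hb b' hb'
    _ = (3 * C_J * C_J' * (1 + 16 / δ ^ 2)) * ∑ b ∈ S, ∑ b' ∈ S, E b * (1 + ((supNorm (b' - b) : ℝ) / n) ^ 2) * κ b b' := by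
        rw [Finset.mul_sum]; exact Finset.sum_congr rfl fun b _ => by rw [Finset.mul_sum]
    _ ≤ (3 * C_J * C_J' * (1 + 16 / δ ^ 2)) * A_κ := mul_le_mul_of_nonneg_left hMκ (by positivity)
    _ = 3 * C_J * C_J' * (1 + 16 / δ ^ 2) * A_κ := by ring

/-- **(MIX-4) MASS-CURRENCY COARSE SECOND MOMENT, n-FREE**: for finite fine windows `S` (both insertions) and coarse window `V`,
`Σ_{v∈V} ‖v − v₀‖∞²·|Σ_{b∈S}Σ_{b′∈S} J b v₀·J b′ v·k₄(b,b′)| ≤ 3·C_J·C_J′·(1 + 16∕δ²)·(C_I·A₂M)` under (I₀), (J), (J′), (M₂) — the J-contraction lemma at the majorant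
`κ₄ = C_I·M₂` of `abs_mix4_le_mass`; the (MIX-4) sibling of the owner's `MixLoopPowerCountingMass.coarse_mix2_secondMoment_le`; FILE A's `mix4_secondMoment_le` is the
uniform special case `M₂ ≤ A₂∕n³` on `‖b′−b‖ ≤ n`. [folklore] -/
theorem coarse_mix4_secondMoment_le (hδ : 0 < δ) (hn : 1 ≤ n) (hI : ∀ c u, |I c u| ≤ C_I) (S V : Finset Pt) (v₀ : Pt)
    (hJ : ∀ b, |J b v₀| ≤ C_J * Real.exp (-(δ / n) * (supNorm (b - (n : ℤ) • v₀) : ℝ)))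
    (hJ' : ∀ b', ∑ v ∈ V, (1 + ((supNorm (b' - (n : ℤ) • v) : ℝ) / n) ^ 2) * |J b' v| ≤ C_J')
    (hM₂ : ∑ b ∈ S, ∑ b' ∈ S, Real.exp (-(δ / (2 * n)) * (supNorm (b - (n : ℤ) • v₀) : ℝ)) *
        (1 + ((supNorm (b' - b) : ℝ) / n) ^ 2) * (∑ u ∈ U b, ∑ w ∈ W, |qdd u b b' (b + w)|) ≤ A₂M) :
    ∑ v ∈ V, (supNorm (v - v₀) : ℝ) ^ 2 *
        |∑ b ∈ S, ∑ b' ∈ S, J b v₀ * J b' v * (∑ u ∈ U b, ∑ w ∈ W, qdd u b b' (b + w) * I (b + w) u)|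
      ≤ 3 * C_J * C_J' * (1 + 16 / δ ^ 2) * (C_I * A₂M) := by
  have hCI : 0 ≤ C_I := (abs_nonneg _).trans (hI v₀ v₀)
  refine coarse_secondMoment_of_majorant (J := J) (k := fun b b' => ∑ u ∈ U b, ∑ w ∈ W, qdd u b b' (b + w) * I (b + w) u)
    (κ := fun b b' => C_I * ∑ u ∈ U b, ∑ w ∈ W, |qdd u b b' (b + w)|) hδ hn S V v₀ (fun b b' => abs_mix4_le_mass hI b b') hJ hJ' ?_
  calc ∑ b ∈ S, ∑ b' ∈ S, Real.exp (-(δ / (2 * n)) * (supNorm (b - (n : ℤ) • v₀) : ℝ)) *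
        (1 + ((supNorm (b' - b) : ℝ) / n) ^ 2) * (C_I * ∑ u ∈ U b, ∑ w ∈ W, |qdd u b b' (b + w)|)
      = C_I * ∑ b ∈ S, ∑ b' ∈ S, Real.exp (-(δ / (2 * n)) * (supNorm (b - (n : ℤ) • v₀) : ℝ)) *
        (1 + ((supNorm (b' - b) : ℝ) / n) ^ 2) * (∑ u ∈ U b, ∑ w ∈ W, |qdd u b b' (b + w)|) := by
        rw [Finset.mul_sum]; refine Finset.sum_congr rfl fun b _ => ?_
        rw [Finset.mul_sum]; exact Finset.sum_congr rfl fun b' _ => by ring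
    _ ≤ C_I * A₂M := mul_le_mul_of_nonneg_left hM₂ hCI

end Mix4

end Summit.QuantumFields.BalabanUV.Beta.FP.MixLoopPowerCountingMassQuartic

end
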